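import Summits.QuantumFields.YangMills.Theorems.UnitScaleTiltFluctuationComparisonRegPrAnsatzTRowsB
import Summits.QuantumFields.YangMills.Theorems.UnitScaleTiltFluctuationComparisonRegPrLiftLegsSlice
import Summits.QuantumFields.YangMills.Theorems.UnitScaleTiltFluctuationComparisonRegPrLiftLegsAssembly
import Summits.QuantumFields.YangMills.Theorems.UnitScaleTiltFluctuationComparisonRegPrLiftLegsClose

/-!
# Route `UnitScaleTilt` — crux K1bR-pr `FluctuationComparisonRegPrL` (stmt-QuantumFields-19935, ex 19201), stub `stub_oneStepSmallLift`
# (W7 line), «ANSATZ T» part 4 — THE ROW BOUND `RowBound n 1 (kzT L) (18/L²) 1` FOR EVERY ODD `L ≥ 3`, the kernel hypotheses of the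
# tensor table at every run of a `T3Family`, and the gain `(18/L²)·√L < 1` for `L ≥ 7` (support file `--supports stmt-QuantumFields-19935`)

Cell `ym3-torus` (rung R3), seat `ym3-torus-p2` gen 10 (IR-NODE §16).  Assembly of parts 1–3 (`…AnsatzT1D{,Identities}`, `…AnsatzTKernel`,
`…AnsatzTBox`, `…AnsatzTTerms`, `…AnsatzTRows{,B}`).

* **`rowBound_T`**: `RowBound n 1 (kzT L) (18/L²) 1` for the literal `d = 3` parameters of block size `L` (odd, `≥ 3`): the three
  orientation classes `rowT01`, `rowT02`, `rowT12`;
* **`kzT_hypotheses`**: at every run `K` of a `T3Family` with `L ≥ 3`: `SliceNeutral ∧ SNeutral ∧ RowMass 162 ∧ RowBound (18/L²) 1`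
  for the table `kzT F.L` — the (L1) input of the INTERIOR pipeline in the fleet format, for EVERY odd `L`;
* the gain `(18/L²)·√L < 1` for `L ≥ 7` is ym3-torus-p1 g11's `gainT_lt_one` (`…LiftLegsClose`); `L = 3, 5`: CertL3Tree / ANSATZ S;

* **`perL_clause_T`** (odd `L ≥ 7`): the per-`L` hypothesis of `ApproxLift.oneStepSmallLift_stub_of_approx`, by ym3-torus-p1 g11's
  INTERIOR assembly `exists_approxSmallLift_of_kernel_lineNeutral` (`…LiftLegsAssembly`, accuracy from the Γ-leg layer through
  `LineNeutral`, which `SliceNeutral` implies: `lineNeutral_of_sliceNeutral`, `…LiftLegsSlice`); **`perL_clause_all`** (every odd `L ≥ 5`;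
  `L = 5` from ANSATZ S `AnsatzS.perL_clause`); and **`oneStepSmallLift_stub_of_certL3`**: THE REGISTERED SIGNATURE OF
  `stub_oneStepSmallLift` MODULO THE `L = 3` CLAUSE (the fleet's CertL3Tree glue), via p1 g11's `oneStepSmallLift_stub_of_perL`.

Elementary; nothing of Bałaban's is asserted.
-/

noncomputable section

open scoped BigOperators Matrix.Norms.L2Operator

namespace Summit.QuantumFields.YangMills.Theorems.ApproxLift.AnsatzT

open Literature.MathematicalPhysics.QuantumFieldTheory.Balaban1983to89
open Literature.MathematicalPhysics.QuantumFieldTheory.Balaban1983to89.T3ContinuumYM3Torus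
open T4Continuum BlockAveraging
open Literature.MathematicalPhysics.QuantumFieldTheory.Balaban1983to89.T3UnitLawDensityEML (ℰp)
open Literature.MathematicalPhysics.QuantumFieldTheory.Balaban1983to89.T3SmallLiftHistory (OneStepSmallLift)
open AnsatzS (P3 o01 o02 o12)

section RB

variable {n : Type*} [Fintype n] [DecidableEq n]
variable {L m K : ℕ} {hL : Odd L ∧ 1 < L}

/-- **THE ROW BOUND OF THE TENSOR TABLE**: `λ = 18/L²`, `β = 1` (odd `L ≥ 3`; any `m`, `K`, `n`). -/
theorem rowBound_T (hodd : Odd L) (h3 : 3 ≤ L) : RowBound (P := P3 L m K hL) n 1 (kzT L) (18 / (L : ℝ) ^ 2) 1 := by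
  intro μ ν hμν pp w Bw Bd hw hd
  have hBw : 0 ≤ Bw := (norm_nonneg _).trans (hw ⟨(μ, ν), hμν⟩ 0)
  have hd' : ∀ s : Fin 3 → ℤ, (∀ i, (s i).natAbs ≤ 1 + 1) → ‖d2 w 0 1 2 o01.2 o12.2 s‖ ≤ Bd :=
    fun s hs => hd 0 1 2 _ _ s hs
  have hBd : 0 ≤ Bd := (norm_nonneg _).trans (hd' 0 AnsatzS.natAbs_zero_apply)
  obtain ⟨rfl, rfl⟩ | ⟨rfl, rfl⟩ | ⟨rfl, rfl⟩ := AnsatzS.orient_cases μ ν hμν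
  · exact rowT01 hodd h3 pp w hw hd' hBw hBd
  · exact rowT02 hodd h3 pp w hw hd' hBw hBd
  · exact rowT12 hodd h3 pp w hw hd' hBw hBd

end RB

/-- The table does not depend on the run: it is a function of `L` alone (recorded for the assembly). -/
theorem kzT_run_free (F : T3Family) (K : ℕ) : (F.P K).L = (F.P 0).L := rfl

/-- **THE KERNEL HYPOTHESES OF ANSATZ T AT EVERY RUN** of a family of block size `L ≥ 3`: slice neutrality (hence S-neutrality),
row mass `162`, and the row bound `(18/L², 1)` — everything `exists_approxSmallLift_of_kernel` asks of a table EXCEPT face support,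
which the interior pipeline replaces by the gauge form of the accuracy clause. -/
theorem kzT_hypotheses (F : T3Family) (hF : 3 ≤ F.L) (K : ℕ) :
    SliceNeutral (P := F.P K) 1 (kzT F.L) ∧ SNeutral (P := F.P K) 1 (kzT F.L) ∧ RowMass (P := F.P K) 1 (kzT F.L) 162 ∧
      RowBound (P := F.P K) (Fin 2) 1 (kzT F.L) (18 / (F.L : ℝ) ^ 2) 1 :=
  ⟨sliceNeutral_T (m := F.m) (K := K) (hL := F.hL) F.hL.1, sNeutral_T (m := F.m) (K := K) (hL := F.hL) F.hL.1,
    rowMass_T (m := F.m) (K := K) (hL := F.hL) F.hL.1 hF, rowBound_T (m := F.m) (K := K) (hL := F.hL) (n := Fin 2) F.hL.1 hF⟩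

/-! ## The per-`L` clauses and the stub modulo `L = 3` -/

/-- **THE PER-`L` CLAUSE FROM ANSATZ T** (odd `L ≥ 7`): table `kzT`, `K₁ = 162`, `λ = 18/L²`, `β = 1`, accuracy through slice neutrality
and the Γ-leg layer (`exists_approxSmallLift_of_kernel_lineNeutral`). -/
theorem perL_clause_T {L : ℕ} (hodd : Odd L) (h7 : 7 ≤ L) :
    ∃ κ₀ C δ₀ : ℝ, 0 ≤ κ₀ ∧ κ₀ * Real.sqrt L < 1 ∧ 0 ≤ C ∧ 0 < δ₀ ∧
      ∀ F : T3Family, F.L = L → ApproxSmallLift F κ₀ C δ₀ := by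
  have hL' : Odd L ∧ 1 < L := ⟨hodd, by omega⟩
  have hlam : (0 : ℝ) ≤ 18 / (L : ℝ) ^ 2 := by positivity
  have hK : (0 : ℝ) ≤ 162 := by norm_num
  refine exists_approxSmallLift_of_kernel_lineNeutral L 1 (fun F => kzT F.L) (K₁ := 162) (lam := 18 / (L : ℝ) ^ 2) (β := 1)
    (Cq₀ := Cq (P3 L 1 0 hL') 1 (18 / (L : ℝ) ^ 2) 1 162) (Ca₀ := Ca (P3 L 1 0 hL') 1 162)
    hK hlam zero_le_one (gainT_lt_one h7) (Cq_nonneg _ _ hlam zero_le_one hK) (Ca_nonneg _ _ hK) fun F hFL => ⟨le_of_eq rfl, ?_, fun K => ?_⟩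
  · obtain ⟨L', hL'', m, hm⟩ := F
    cases hFL
    exact le_of_eq rfl
  · have hF3 : 3 ≤ F.L := by rw [hFL]; omega
    have hRB := rowBound_T (m := F.m) (K := K) (hL := F.hL) (n := Fin 2) F.hL.1 hF3
    have hc : (18 / (F.L : ℝ) ^ 2) = 18 / (L : ℝ) ^ 2 := by rw [hFL]
    rw [hc] at hRB
    exact ⟨lineNeutral_of_sliceNeutral (sliceNeutral_T (m := F.m) (K := K) (hL := F.hL) F.hL.1),
      rowMass_T (m := F.m) (K := K) (hL := F.hL) F.hL.1 hF3, hRB⟩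

/-- **THE PER-`L` CLAUSE FOR EVERY ODD `L ≥ 5`** (`L = 5`: ANSATZ S; `L ≥ 7`: ANSATZ T). -/
theorem perL_clause_all {L : ℕ} (hodd : Odd L) (h5 : 5 ≤ L) :
    ∃ κ₀ C δ₀ : ℝ, 0 ≤ κ₀ ∧ κ₀ * Real.sqrt L < 1 ∧ 0 ≤ C ∧ 0 < δ₀ ∧
      ∀ F : T3Family, F.L = L → ApproxSmallLift F κ₀ C δ₀ := by
  by_cases h7 : 7 ≤ L
  · exact perL_clause_T hodd h7
  · have hL5 : L = 5 := by obtain ⟨t, ht⟩ := hodd; omega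
    subst hL5
    exact AnsatzS.perL_clause hodd (le_refl _) (by norm_num)

/-- **THE REGISTERED SIGNATURE OF `stub_oneStepSmallLift` MODULO THE `L = 3` CLAUSE** (the fleet's `CertL3Tree` glue): for every block
size `L`, one-step small lifts with `κ√L ≤ 1` for every `T3Family` of block size `L`. -/
theorem oneStepSmallLift_stub_of_certL3
    (h3 : ∃ κ₀ C δ₀ : ℝ, 0 ≤ κ₀ ∧ κ₀ * Real.sqrt (3 : ℕ) < 1 ∧ 0 ≤ C ∧ 0 < δ₀ ∧
      ∀ F : T3Family, F.L = 3 → ApproxSmallLift F κ₀ C δ₀) :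
    ∀ L : ℕ, ∃ κ δ₀ : ℝ, κ * Real.sqrt L ≤ 1 ∧ 0 < δ₀ ∧ ∀ F : T3Family, F.L = L → OneStepSmallLift F ℰp κ δ₀ :=
  oneStepSmallLift_stub_of_perL h3 fun _ hodd h5 => perL_clause_all hodd h5

end Summit.QuantumFields.YangMills.Theorems.ApproxLift.AnsatzT

end
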